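import Summits.CriticalPhenomena.PercolationContinuityZ3.Theorems.PercNearOneGluingNoHeavyLowerTailKnQuestion8CoefficientwiseCoreClassKernelMixHubPathJU
import Summits.CriticalPhenomena.PercolationContinuityZ3.Theorems.PercNearOneGluingNoHeavyLowerTailKnQuestion8CoefficientwiseCoreClassKernelMixHubPathFlip
import HarnessLib

/-!
# The path lemma on a single edge and the final statements for `ℓ ≥ 1` (PATH LEMMA of hub-Kleitman, all gate types)

Support file (`--supports stmt-CriticalPhenomena-4575`, closed), prover `prim-cplus-coupling` (gen 51).  No definitions, no notations,
no named facts, no sorries; standard axioms.  Memo `prim-cplus-coupling/A5-COUPLING-gen51.md` §1–§2; memo-50 §2.8.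

On the path with one edge (`ℓ = 1`) there are two words, `∅` (blue) and `{1}` (red), every `j`-value is `{w₀, w₁}`, and the only hub move is
`∅ ↦ {1}`.  `hubPath_one_flip` settles every gate type there: if each source is the blue word and, when a source exists, the red word is a target,
then `#(F ∩ W) ≤ #(F ∩ cW)`.  `hubPath_jj_one`, `hubPath_uj_one`, `hubPath_ju_one` are the three instances ((u,u) is `hubPath_uu`, valid for `ℓ ≥ 1`),
and `hubPath_jj'`, `hubPath_uj'`, `hubPath_ju'` are the word-form PATH LEMMA for all `ℓ ≥ 1` (memo-50 §2.8, gate types `(j,j)`, `(u,j)`, `(j,u)`).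
[cite: KozmaNitzan2024, Questions 8–9 (§5.5 p. 36) (context)]
-/

namespace Summit.CriticalPhenomena.PercolationContinuityZ3.Theorems

open Finset
open scoped symmDiff

namespace Coefficientwise

open Classical in
/-- One edge: if sources are blue (`1 ∉ ω`) and, given a source, the red word `{1}` is a target, then `#(F ∩ W) ≤ #(F ∩ cW)` for every
family `F` of words in `[1,1]` closed under the move `∅ ↦ {1}`. [folklore] -/
theorem hubPath_one_flip (W cW : Finset ℕ → Prop)
    (hsrc : ∀ ω : Finset ℕ, ω ⊆ Icc 1 1 → W ω → ¬ cW ω → 1 ∉ ω ∧ cW {1} ∧ ¬ W {1})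
    (F : Finset (Finset ℕ)) (hFsub : ∀ ω ∈ F, ω ⊆ Icc 1 1)
    (hFup : ∀ ω ∈ F, ∀ a b : ℕ, a ≤ b → b ≤ 1 → (∀ k ∈ ω, a < k) → (∀ k ∈ ω, k ≤ b) →
      ω ∪ Icc 1 a ∪ Icc (b + 1) 1 ∈ F) :
    (F.filter (fun ω => W ω)).card ≤ (F.filter (fun ω => cW ω)).card := by
  classical
  have hWf : F.filter (fun ω => W ω) = F.filter (fun ω => ω ⊆ Icc 1 1 ∧ W ω) := by
    ext ω; simp only [Finset.mem_filter]
    exact ⟨fun ⟨hF, hw⟩ => ⟨hF, hFsub ω hF, hw⟩, fun ⟨hF, _, hw⟩ => ⟨hF, hw⟩⟩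
  have hcWf : F.filter (fun ω => cW ω) = F.filter (fun ω => ω ⊆ Icc 1 1 ∧ cW ω) := by
    ext ω; simp only [Finset.mem_filter]
    exact ⟨fun ⟨hF, hw⟩ => ⟨hF, hFsub ω hF, hw⟩, fun ⟨hF, _, hw⟩ => ⟨hF, hw⟩⟩
  have hempty : ∀ ω : Finset ℕ, ω ⊆ Icc 1 1 → 1 ∉ ω → ω = ∅ := by
    intro ω hω h1
    rw [Finset.eq_empty_iff_forall_notMem]
    intro k hk
    have := Finset.mem_Icc.mp (hω hk)
    have hk1 : k = 1 := by omega
    exact h1 (hk1 ▸ hk)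
  rw [hWf, hcWf]
  refine hub_card_filter_le_of_moveInjection F (fun ω => ω ⊆ Icc 1 1 ∧ W ω) (fun ω => ω ⊆ Icc 1 1 ∧ cW ω)
    (fun ω ω' => ω = ∅ ∧ ω' = ω ∪ Icc 1 1 ∪ Icc (1 + 1) 1) ?_ (fun _ => {1}) ?_ ?_
  · rintro ω hω ω' ⟨rfl, rfl⟩
    exact hFup ∅ hω 1 1 (le_refl _) (le_refl _) (by simp) (by simp)
  · rintro ω ⟨hω, hWω⟩ hnc
    obtain ⟨h1, hc, hnw⟩ := hsrc ω hω hWω (fun h => hnc ⟨hω, h⟩)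
    have hω0 := hempty ω hω h1
    refine ⟨⟨fun k hk => ?_, hc⟩, fun h => hnw h.2, hω0, ?_⟩
    · rw [Finset.mem_singleton] at hk; rw [hk]; exact Finset.mem_Icc.mpr ⟨le_refl _, le_refl _⟩
    · rw [hω0]; decide
  · rintro ω ω' ⟨hω, hWω⟩ hnc ⟨hω', hWω'⟩ hnc' _
    rw [hempty ω hω (hsrc ω hω hWω (fun h => hnc ⟨hω, h⟩)).1,
      hempty ω' hω' (hsrc ω' hω' hWω' (fun h => hnc' ⟨hω', h⟩)).1]

/-- The wall set of a word on one edge is empty. [folklore] -/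
theorem hubPath_walls_one (D : Finset ℕ → Finset ℕ)
    (hD : ∀ ω, D ω = (Icc 1 (1 - 1)).filter (fun k => ¬ (k ∈ ω ↔ k + 1 ∈ ω))) (ω : Finset ℕ) : D ω = ∅ := by
  rw [hD, Finset.filter_eq_empty_iff]
  intro k hk
  have := Finset.mem_Icc.mp hk
  omega

open Classical in
/-- **PATH LEMMA, gate type `(j,j)`, one edge.** [folklore] -/
theorem hubPath_jj_one (X Y : Finset ℕ → Prop)
    (D : Finset ℕ → Finset ℕ) (hD : ∀ ω, D ω = (Icc 1 (1 - 1)).filter (fun k => ¬ (k ∈ ω ↔ k + 1 ∈ ω)))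
    (ri ra rj rb : Finset ℕ → ℕ)
    (hri : ∀ ω, ri ω = if 1 ∈ ω then (if h : (D ω).Nonempty then (D ω).min' h else 1) else 0)
    (hra : ∀ ω, ra ω = if 1 ∈ ω then 0 else (if h : (D ω).Nonempty then (D ω).min' h else 1))
    (hrj : ∀ ω, rj ω = if 1 ∈ ω then (if h : (D ω).Nonempty then 1 - (D ω).max' h else 1) else 0)
    (hrb : ∀ ω, rb ω = if 1 ∈ ω then 0 else (if h : (D ω).Nonempty then 1 - (D ω).max' h else 1))
    (W cW : Finset ℕ → Prop)
    (hW : ∀ ω, W ω ↔ ¬ X (Icc 0 (ri ω) ∪ Icc (1 - rj ω) 1) ∧ Y (Icc 0 (ra ω) ∪ Icc (1 - rb ω) 1))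
    (hcW : ∀ ω, cW ω ↔ ¬ X (Icc 0 (ra ω) ∪ Icc (1 - rb ω) 1) ∧ Y (Icc 0 (ri ω) ∪ Icc (1 - rj ω) 1))
    (F : Finset (Finset ℕ)) (hFsub : ∀ ω ∈ F, ω ⊆ Icc 1 1)
    (hFup : ∀ ω ∈ F, ∀ a b : ℕ, a ≤ b → b ≤ 1 → (∀ k ∈ ω, a < k) → (∀ k ∈ ω, k ≤ b) →
      ω ∪ Icc 1 a ∪ Icc (b + 1) 1 ∈ F) :
    (F.filter (fun ω => W ω)).card ≤ (F.filter (fun ω => cW ω)).card := by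
  classical
  have h0 := hubPath_walls_one D hD
  have e1 : Icc 0 0 ∪ Icc 1 1 = Icc 0 1 := by decide
  have e2 : Icc 0 1 ∪ Icc 0 1 = Icc 0 1 := by decide
  have hval : ∀ ω, (Icc 0 (ri ω) ∪ Icc (1 - rj ω) 1 = Icc 0 1) ∧ (Icc 0 (ra ω) ∪ Icc (1 - rb ω) 1 = Icc 0 1) := by
    intro ω
    rw [hri, hra, hrj, hrb]
    simp only [h0, Finset.not_nonempty_empty, dif_neg, not_false_eq_true]
    by_cases h1 : 1 ∈ ω
    · simp only [if_pos h1]; exact ⟨e2, e1⟩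
    · simp only [if_neg h1]; exact ⟨e1, e2⟩
  refine hubPath_one_flip W cW (fun ω _ hWω hncW => ?_) F hFsub hFup
  exfalso
  rw [hW, (hval ω).1, (hval ω).2] at hWω
  rw [hcW, (hval ω).1, (hval ω).2] at hncW
  exact hncW hWω

open Classical in
/-- **PATH LEMMA, gate type `(u,j)`, one edge.** [folklore] -/
theorem hubPath_uj_one (X Y : Finset ℕ → Prop) (hXmono : ∀ S T : Finset ℕ, S ⊆ T → X S → X T)
    (D : Finset ℕ → Finset ℕ) (hD : ∀ ω, D ω = (Icc 1 (1 - 1)).filter (fun k => ¬ (k ∈ ω ↔ k + 1 ∈ ω)))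
    (ri ra rj rb : Finset ℕ → ℕ)
    (hri : ∀ ω, ri ω = if 1 ∈ ω then (if h : (D ω).Nonempty then (D ω).min' h else 1) else 0)
    (hra : ∀ ω, ra ω = if 1 ∈ ω then 0 else (if h : (D ω).Nonempty then (D ω).min' h else 1))
    (hrj : ∀ ω, rj ω = if 1 ∈ ω then (if h : (D ω).Nonempty then 1 - (D ω).max' h else 1) else 0)
    (hrb : ∀ ω, rb ω = if 1 ∈ ω then 0 else (if h : (D ω).Nonempty then 1 - (D ω).max' h else 1))
    (W cW : Finset ℕ → Prop)
    (hW : ∀ ω, W ω ↔ ¬ X (Icc 0 (ri ω)) ∧ Y (Icc 0 (ra ω) ∪ Icc (1 - rb ω) 1))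
    (hcW : ∀ ω, cW ω ↔ ¬ X (Icc 0 (ra ω)) ∧ Y (Icc 0 (ri ω) ∪ Icc (1 - rj ω) 1))
    (F : Finset (Finset ℕ)) (hFsub : ∀ ω ∈ F, ω ⊆ Icc 1 1)
    (hFup : ∀ ω ∈ F, ∀ a b : ℕ, a ≤ b → b ≤ 1 → (∀ k ∈ ω, a < k) → (∀ k ∈ ω, k ≤ b) →
      ω ∪ Icc 1 a ∪ Icc (b + 1) 1 ∈ F) :
    (F.filter (fun ω => W ω)).card ≤ (F.filter (fun ω => cW ω)).card := by
  classical
  have h0 := hubPath_walls_one D hD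
  have e1 : Icc 0 0 ∪ Icc 1 1 = Icc 0 1 := by decide
  have e2 : Icc 0 1 ∪ Icc 0 1 = Icc 0 1 := by decide
  have hruns : ∀ ω, (1 ∈ ω → ri ω = 1 ∧ ra ω = 0 ∧ rj ω = 1 ∧ rb ω = 0) ∧ (1 ∉ ω → ri ω = 0 ∧ ra ω = 1 ∧ rj ω = 0 ∧ rb ω = 1) := by
    intro ω
    constructor
    · intro h1; rw [hri, hra, hrj, hrb]; simp [h0, h1]
    · intro h1; rw [hri, hra, hrj, hrb]; simp [h0, h1]
  have hone : (1 : ℕ) ∈ ({1} : Finset ℕ) := Finset.mem_singleton_self _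
  obtain ⟨hr1, _⟩ := hruns {1}
  obtain ⟨e_ri, e_ra, e_rj, e_rb⟩ := hr1 hone
  refine hubPath_one_flip W cW (fun ω _ hWω hncW => ?_) F hFsub hFup
  rw [hW] at hWω
  rw [hcW] at hncW
  by_cases h1 : 1 ∈ ω
  · exfalso
    obtain ⟨q1, q2, _, q4⟩ := (hruns ω).1 h1
    rw [q1, q2, q4, Nat.sub_zero, e1] at hWω
    obtain ⟨_, _, q3', _⟩ := (hruns ω).1 h1
    rw [q2, q1, q3', Nat.sub_self, e2] at hncW
    have hX0 : X (Icc 0 0) := by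
      by_contra h; exact hncW ⟨h, hWω.2⟩
    exact hWω.1 (hXmono _ _ (Finset.Icc_subset_Icc_right (Nat.zero_le _)) hX0)
  · obtain ⟨q1, q2, q3, q4⟩ := (hruns ω).2 h1
    rw [q1, q2, q4, Nat.sub_self, e2] at hWω
    rw [q2, q1, q3, Nat.sub_zero, e1] at hncW
    refine ⟨h1, ?_, ?_⟩
    · rw [hcW, e_ra, e_ri, e_rj, Nat.sub_self, e2]; exact hWω
    · rw [hW, e_ri, e_ra, e_rb, Nat.sub_zero, e1]; exact hncW

open Classical in
/-- **PATH LEMMA, gate type `(j,u)`, one edge.** [folklore] -/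
theorem hubPath_ju_one (X Y : Finset ℕ → Prop) (hYmono : ∀ S T : Finset ℕ, S ⊆ T → Y S → Y T)
    (D : Finset ℕ → Finset ℕ) (hD : ∀ ω, D ω = (Icc 1 (1 - 1)).filter (fun k => ¬ (k ∈ ω ↔ k + 1 ∈ ω)))
    (ri ra rj rb : Finset ℕ → ℕ)
    (hri : ∀ ω, ri ω = if 1 ∈ ω then (if h : (D ω).Nonempty then (D ω).min' h else 1) else 0)
    (hra : ∀ ω, ra ω = if 1 ∈ ω then 0 else (if h : (D ω).Nonempty then (D ω).min' h else 1))
    (hrj : ∀ ω, rj ω = if 1 ∈ ω then (if h : (D ω).Nonempty then 1 - (D ω).max' h else 1) else 0)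
    (hrb : ∀ ω, rb ω = if 1 ∈ ω then 0 else (if h : (D ω).Nonempty then 1 - (D ω).max' h else 1))
    (W cW : Finset ℕ → Prop)
    (hW : ∀ ω, W ω ↔ ¬ X (Icc 0 (ri ω) ∪ Icc (1 - rj ω) 1) ∧ Y (Icc 0 (ra ω)))
    (hcW : ∀ ω, cW ω ↔ ¬ X (Icc 0 (ra ω) ∪ Icc (1 - rb ω) 1) ∧ Y (Icc 0 (ri ω)))
    (F : Finset (Finset ℕ)) (hFsub : ∀ ω ∈ F, ω ⊆ Icc 1 1)
    (hFup : ∀ ω ∈ F, ∀ a b : ℕ, a ≤ b → b ≤ 1 → (∀ k ∈ ω, a < k) → (∀ k ∈ ω, k ≤ b) →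
      ω ∪ Icc 1 a ∪ Icc (b + 1) 1 ∈ F) :
    (F.filter (fun ω => W ω)).card ≤ (F.filter (fun ω => cW ω)).card := by
  classical
  have h0 := hubPath_walls_one D hD
  have e1 : Icc 0 0 ∪ Icc 1 1 = Icc 0 1 := by decide
  have e2 : Icc 0 1 ∪ Icc 0 1 = Icc 0 1 := by decide
  have hruns : ∀ ω, (1 ∈ ω → ri ω = 1 ∧ ra ω = 0 ∧ rj ω = 1 ∧ rb ω = 0) ∧ (1 ∉ ω → ri ω = 0 ∧ ra ω = 1 ∧ rj ω = 0 ∧ rb ω = 1) := by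
    intro ω
    constructor
    · intro h1; rw [hri, hra, hrj, hrb]; simp [h0, h1]
    · intro h1; rw [hri, hra, hrj, hrb]; simp [h0, h1]
  have hone : (1 : ℕ) ∈ ({1} : Finset ℕ) := Finset.mem_singleton_self _
  obtain ⟨hr1, _⟩ := hruns {1}
  obtain ⟨e_ri, e_ra, e_rj, e_rb⟩ := hr1 hone
  refine hubPath_one_flip W cW (fun ω _ hWω hncW => ?_) F hFsub hFup
  rw [hW] at hWω
  rw [hcW] at hncW
  by_cases h1 : 1 ∈ ω
  · exfalso
    obtain ⟨q1, q2, q3, q4⟩ := (hruns ω).1 h1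
    rw [q1, q3, q2, Nat.sub_self, e2] at hWω
    rw [q2, q4, q1, Nat.sub_zero, e1] at hncW
    exact hncW ⟨hWω.1, hYmono _ _ (Finset.Icc_subset_Icc_right (Nat.zero_le _)) hWω.2⟩
  · obtain ⟨q1, q2, q3, q4⟩ := (hruns ω).2 h1
    rw [q1, q3, q2, Nat.sub_zero, e1] at hWω
    rw [q2, q4, q1, Nat.sub_self, e2] at hncW
    refine ⟨h1, ?_, fun h => ?_⟩
    · rw [hcW, e_ra, e_rb, e_ri, Nat.sub_zero, e1]; exact hWω
    · rw [hW, e_ri, e_rj, e_ra, Nat.sub_self, e2] at h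
      exact hncW ⟨h.1, h.2⟩

end Coefficientwise

end Summit.CriticalPhenomena.PercolationContinuityZ3.Theorems
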